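import Summits.HodgeConjecture.HodgeConjecture.Theses.HeckePrymWeil
import Summits.HodgeConjecture.HodgeConjecture.Theses.AnchorTransport
import Summits.HodgeConjecture.HodgeConjecture.Theorems.HeckePrymWeilHeckePrymAnchorsOfStubs
import Summits.HodgeConjecture.HodgeConjecture.Theorems.HeckePrymWeilHeckePrymAnchorsUpgrade
import Summits.HodgeConjecture.HodgeConjecture.Theorems.HeckePrymWeilHeckePrymAnchorsRationalAlongSection
import Summits.HodgeConjecture.HodgeConjecture.Theorems.HeckePrymWeilHeckePrymAnchorsGlobalClassOfLeray
import Summits.HodgeConjecture.HodgeConjecture.Theorems.HeckePrymWeilWeilTenfoldsSqrtMinus11NormAnchorCrux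
import Literature.AlgebraicGeometry.HodgeTheory.WeilFamilyFlatSections
import Literature.AlgebraicGeometry.HodgeTheory.InvariantClassesFromTotalSpace
import Literature.AlgebraicGeometry.HodgeTheory.SemiregularVariationalHodge
import Literature.AlgebraicGeometry.HodgeTheory.SemiregularityHigherSigma
import Literature.AlgebraicGeometry.HodgeTheory.SemiregularVariationalHodgeFull
import Literature.AlgebraicGeometry.HodgeTheory.StandardChernCharacterBetti
import Literature.AlgebraicGeometry.HodgeTheory.ComplexConjugationHolds
import Literature.AlgebraicGeometry.HodgeTheory.AbelJacobiPullbackHodgeSection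
import Literature.AlgebraicGeometry.HodgeTheory.HodgeTypeConjugation
import Literature.AlgebraicGeometry.HodgeTheory.GysinFormalismHodgeOfGysin
import Literature.AlgebraicGeometry.Motives.VarietiesGeometricallyIntegralProofs
import HarnessLib
import HarnessLib.Audit
import Summits.HodgeConjecture.HodgeConjecture.Theorems.HeckePrymWeilHeckePrymAnchorsOfDeligneWeilFamilyDecl
import Literature.AlgebraicGeometry.HodgeTheory.AlgebraicClassesCupAbelianVariety
import Literature.AlgebraicGeometry.HodgeTheory.WeilTypePeriodPoint
import Literature.AlgebraicGeometry.HodgeTheory.WeilFamilyKAction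
import Literature.AlgebraicGeometry.HodgeTheory.WeilFamilyBalanced
import Literature.AlgebraicGeometry.HodgeTheory.InvariantClassesFromTotalSpaceHolds
import Literature.AlgebraicGeometry.HodgeTheory.LefschetzOneOneHolds
import Literature.AlgebraicGeometry.HodgeTheory.HodgeTypeExteriorProduct
import Literature.AlgebraicGeometry.HodgeTheory.FermatHypersurfaceReduction
import Literature.AlgebraicGeometry.HodgeTheory.AlgebraicClassesHodgeTypeHolds
import Literature.AlgebraicGeometry.HodgeTheory.HolomorphicBundleChernCharacterProjectiveSpace
import Literature.AlgebraicGeometry.HodgeTheory.FubiniStudyClassRational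

/-!
# Line `quaternionic-norm-anchors` — crux `HeckePrymWeil.WeilTenfoldsSqrtMinus11` (stmt-HodgeConjecture-1262)
# Skeleton v3 (lead c3, 2026-08-17): THE POLARISED BET + THE ROUTE-ITEM FAMILY

Crux (route `HeckePrymWeil`, r4): on every complex abelian TENFOLD `A` with `φ ≫ φ = -11`, every rational
`(5,5)`-class of the literal Weil plane `Eig((𝟙+φ)^*, (1+i√11)¹⁰) ⊔ Eig((𝟙+φ)^*, (1-i√11)¹⁰)` is algebraic.

## The composition idea of the line (unchanged since v1) and what v3 changes

(anchor fibre where the Weil plane is ALGEBRAIC) + (smooth projective family through the anchor and through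
`A` with flat Hodge sections) + (a semiregular locally free object at the anchor whose Chern character is the
anchor value of those sections) + (Perry 2026 Thm 1.1 (2): the Chern character of a semiregular object remains
algebraic along the family) ⇒ the Weil class of `A` is algebraic.

v1 (planner + lead c1) anchored at NORM ANCHORS (crux PROVED there, `…NormAnchorCrux` p112065; no family fact through
them).  v2/v2.1 (lead c2) anchored at the TENSOR-ISOGENOUS FIBRE of Deligne's Weil family (named fact
`deligne1982_weilFamily_hodgeWeilSection`) and asked the bet for a WEIL-PURE Chern character `r₀·1 + r·x₀` — a
typing now believed FALSE for every semiregular `E₀` (cross-crux note of the strategist of stmt-1260, accepted by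
c2, `TensorAnchorDesign.md` §7: along the unpolarised `K`-torus germ `1` and `W` stay Hodge, so Buchweitz–Flenner
relative smoothness deforms `E₀` to the generic `K`-torus where Bogomolov–Bando–Siu with `ch₂ = 0` forces
`ch = rank`).  v3 (this file) makes the two repairs c2 queued:

* STUB B := `stub_tensorAnchorObjectPol` — the bet WITH POLARIZATION POWERS: `ch_k(E₀) = q_k·θ^k` (`k ≠ 5`),
  `ch₅(E₀) = q₅·θ⁵ + r·x`, `r ∈ ℚˣ`, where `θ = 11·ι^*a + Ψ^*ι^*a` is the `K`-SYMMETRISED hyperplane class of ANY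
  projective embedding `ι` of the anchor `Y` and any non-zero rational `a ∈ H²(ℙᴺ)` (the route's polarization
  typing, as in `IsHyperbolicWeilType`; sibling precedent: crux 14642's `SecantAnchorObject47` /
  `Theorems/HeckePrymWeilHyperbolicEightfoldsSqrtMinus7OfAnchorObject`).  Every honest witness lives here: c2's
  line-bundle designs at the CM anchor have `Σ ch(L_{H_t}) ∈ ℚ[θ] ⊕ W` (his §§2–6 are unaffected by the repair),
  Markman's secant sheaves have `κ`-classes in `ℚ[θ] ⊕ W`.
* STUB F := `stub_deligneWeilFamily` — the ROUTE ITEM `HeckePrymWeil.DeligneWeilFamily` (stmt-HodgeConjecture-16866)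
  BY NAME (route-choice advisory 2026-08-16T22:21Z: the family is an obligation of the route, not a named-fact
  stub of this line), consumed through the landed `deligneWeilFamilyDecl_iff_kAction` /
  `deligne1982_weilFamily_globalAction_of_kAction`; its total-space `√-11`, `g : 𝒳 ⟶ 𝒳`, is KEPT by the package
  `hodgeWeilSectionG_of_globalAction` (§2) because it builds the GLOBAL `K`-symmetrised class `11·Θ + g^*Θ`.

## Registered stubs of v3 (the only `sorry`s of this file)

* `stub_deligneWeilFamily` — route crux stmt-16866 verbatim (by name).
* `stub_semiregularFullVariationalHodge` — Perry's theorem with the source's FULL semiregularity, the named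
  claim-fact `HodgeTheory.Perry2026_semiregularFull_remainsAlgebraic` verbatim (kept from v2.1, ACCEPTED p129195).
* `stub_chernCharacterOnBetti` — `Nonempty StandardChernCharacterBetti` (construction debt, kept from v1).
* `stub_tensorAnchorObjectPol` — THE BET (polarised; replaces v2.1's `stub_tensorAnchorObjectFull`).

PROVED here (no `sorry`): `hodgeWeilSectionG_of_globalAction` (§2), the engine `qna_engine_of_perry` (§3, the
sibling's `AnchorObject.engine_of_perry` at general `n`, copy), and the composition `WeilTenfoldsSqrtMinus11_of`
(§4, BY NAME) — landed together as `Theorems/HeckePrymWeilWeilTenfoldsSqrtMinus11TensorAnchorPerryPol`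
(`stub_perryRouteCompositionPol`, this cycle).  The v2/v2.1 compositions stay landed (p116927, p129437) as do
`stub_sectionSmul` (p116295) and the engine-agnostic residue `stub_ofTwoFactsOfWeilVariationalHodge` (p116507,
§5 below: crux ⟸ deligne1968 (proved) + DeligneWeilFamily + WeilVariationalHodge(11,5)).

MECHANISM of §4: given `(A, φ)` and a non-zero rational `(5,5)` class `c` of the typed plane — strong plane
(`stub_upgrade`, landed); F gives `f : 𝒳 → S` through `e : A ≅ 𝒳_{s₁}` with `g`, the continuous Weil section `σ`
through `c` (fibrewise Hodge by §2, rational along by `stub_rationalAlongSection`, globalised to `W ∈ H¹⁰(𝒳)` by the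
PROVED Leray engine `stub_globalClassOfSection_of_leray deligne1968_invariantClass_fromTotalSpace_holds`) and the
anchor `e₀ : Y ≅ 𝒳_{s₀}` with `σ(s₀) ≠ 0` (identity principle `gcs_section_eq_of_eq`) in the strong Weil plane of
`(Y, Ψ)`; all fibres embed in one `ℙᵐ` by `ε` (`exists_forall_isClosedImmersion_fiberι_comp`), `m ≥ 10`, so a
non-zero rational `a ∈ H²(ℙᵐ)` exists and `Θ_K := 11·ε^*a + g^*ε^*a` is GLOBAL with rational `(1,1)` restrictions
`11·θ_s + g_s^*θ_s`, equal through `e₀` to the bet's `θ` for the embedding `e₀ ≫ ι_{s₀} ≫ ε`; C and B give `E₀` on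
`𝒳_{s₀}`; the engine (P) makes `q₅·Θ_K|_{s₁}⁵ + r·W|_{s₁}` algebraic; `Θ_K|_{s₁}⁵` is algebraic on `A ≅ 𝒳_{s₁}`
(DISCHARGED `lefschetzOneOne_rational_holds` + Kleiman `cupPowTwo_mem_algebraicClasses_abelian`); so `r·e^{-1*}c`,
hence `c`, is algebraic (`IsoInvariance`).  No one-class-suffices, no isogeny descent.

## Disproof used (`Cruxes/WeilTenfoldsSqrtMinus11/Disproof.lean`, cycle 3, re-read 2026-08-17T02:5xZ: unchanged since c2)

F1 (`¬crux → ¬HC`): no stub is refutable short of a Hodge counterexample on an abelian variety; §B `hhodge`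
load-bearing — USED (F consumes the `(5,5)` class, the bet consumes a `(5,5)` Weil class); §C/§G/§H typing — the
strong-plane upgrade is the PROVED `stub_upgrade`; §D targets concern the secant line; SCOPE REMARK (every δ)
honoured: F reaches a tensor-isogenous fibre in EVERY component.  `ledger negatives --problem HodgeConjecture`:
unrelated entries.  The objection that killed v2.1's typing came from the sibling crux 1260's strategist census
(K2 barrier B6), not from this Disproof; v3's bet keeps `ch₁ = q₁θ` free, which pins the deformations of `E₀` to
POLARISED ones and evades that argument.
-/

noncomputable section

-- single-problem summit (Problem = Summit): the mandated namespace repeats `HodgeConjecture`.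
set_option linter.dupNamespace false

open CategoryTheory AlgebraicGeometry Limits MonoidalCategory CartesianMonoidalCategory
open Literature.AlgebraicGeometry Literature.AlgebraicGeometry.Motives
  Literature.AlgebraicGeometry.HodgeTheory
open Literature.AlgebraicTopology.SingularHomology
open Summit.HodgeConjecture.HodgeConjecture.Theorems.HeckePrymWeilLine
  (stub_upgrade stub_rationalAlongSection stub_globalClassOfSection_of_leray gcs_section_eq_of_eq
    owf_isoTransport owf_anchorAlgebraic deligneWeilFamilyDecl_iff_kAction)

namespace Summit.HodgeConjecture.HodgeConjecture.Cruxes.WeilTenfoldsSqrtMinus11.QuaternionicNormAnchors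

/-! ## §1 The registered stubs (explicit statements over route / Literature / Mathlib declarations only) -/

/-- **STUB F** (registered `stub_deligneWeilFamily`; replaces v2's `stub_weilFamilyFact`) — **Deligne's Weil family
through `A`, AS THE ROUTE ITEM, BY NAME**: the route crux `HeckePrymWeil.DeligneWeilFamily`
(stmt-HodgeConjecture-16866; the promoted named fact `deligne1982_weilFamily_kAction` in global-class rendering,
equivalent to it by the landed `deligneWeilFamilyDecl_iff_kAction`).  Used at `(p, k) = (11, 5)`.  Its debt (PEL
Shimura varieties with universal abelian scheme, Baily–Borel) is the route's, carried by item 16866.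
[cite: Deligne1982HodgeCycles, proof of Thm. 4.8 (pp. 47–52), clauses (b), (c), with Prop. 4.4]
[cite: vanGeemen1994HodgeAV, §5.3–5.11] [cite: Andre1996Motifs, Lemme 6.3.3] -/
theorem stub_deligneWeilFamily : Summit.HodgeConjecture.HodgeConjecture.Theses.HeckePrymWeil.DeligneWeilFamily := by
  sorry

/-- **STUB P** (registered `stub_semiregularFullVariationalHodge`; kept from v2.1) — **Perry's theorem with FULL
semiregularity, BY NAME**: the tree's named fact `HodgeTheory.Perry2026_semiregularFull_remainsAlgebraic`
(`Literature/AlgebraicGeometry/HodgeTheory/SemiregularVariationalHodgeFull.lean`, ACCEPTED p129195: Perry Thm 1.1 (2)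
with the source's semiregularity `IsISemiregular hE₀ Set.univ`).  OPEN as a claim-fact (arXiv:2604.00511, unrefereed).
[claim: Perry2026Semiregularity, status: under-review] [cite: BuchweitzFlenner2003, Thm. 5.1] -/
theorem stub_semiregularFullVariationalHodge : Perry2026_semiregularFull_remainsAlgebraic := by
  sorry

/-- **STUB C** (registered `stub_chernCharacterOnBetti`; kept from v1) — a standard Chern character on the
real carriers exists (construction, D-0026: topological bundle of a locally free sheaf + GAGA/Dolbeault +
Chern–Weil; c1 worker report `StubChernCharacterOnBetti.BLOCKED.md`). -/
theorem stub_chernCharacterOnBetti : Nonempty StandardChernCharacterBetti := by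
  sorry

/-- **STUB B** (registered `stub_tensorAnchorObjectPol`; THE BET, v3 polarised form; replaces v2.1's Weil-pure
`stub_tensorAnchorObjectFull`) — A SEMIREGULAR
VECTOR BUNDLE WITH POLARISED WEIL CHARGE ON EVERY TENSOR-ISOGENOUS `√-11` TENFOLD: for every standard Chern
character `C`, every abelian tenfold `(Y, Ψ)`, `Ψ ≫ Ψ = -11`, with an isogeny pair `(f₁, g₁, m)` towards a tensor
point `(A₁ × A₁, (x, y) ↦ (-11·y, x))`, `A₁` an abelian fivefold (the special fibre of the route item
`DeligneWeilFamily`: the diagonal CM point `E_K^{10}` of the component, or `A₀ ⊗ K` in the split one), every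
projective embedding `ι : Y ↪ ℙᴺ` and non-zero rational `a ∈ H²(ℙᴺ)` — giving the `K`-SYMMETRISED hyperplane class
`θ = 11·ι^*a + Ψ^*ι^*a` (a `K`-compatible polarization class up to `ℚˣ`) — and every non-zero rational `(5,5)` class
`x` of the strong Weil plane `weilClassesOf Y Ψ 5 11`, there is, on every `ℂ`-scheme `F₀ ≅ Y` (the fibre through
`e₀`; Perry's theorem needs the object ON the fibre), a finite locally free SEMIREGULAR (`IsISemiregular hE₀ Set.univ`,
the full Buchweitz–Flenner map injective) `E₀` with `ch_k(E₀) = q_k·θ^k` (`k ≠ 5`) and `ch₅(E₀) = q₅·θ⁵ + r·x`,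
`r ∈ ℚˣ`, transported along `e₀`.  WHY PLAUSIBLY TRUE / THE WORK: the class exists in `K₀ ⊗ ℚ` (Weil classes are
algebraic on `Y`, `owf_anchorAlgebraic`; `ch : K₀ ⊗ ℚ ≅ CH ⊗ ℚ`), so the content is SEMIREGULARITY of a
representative, now with the polarization powers every honest witness carries: at the CM anchor `E_K^{10}` lead
c2's direct sums of line bundles `⊕ L_{H_t}` with `Σ_t ch(L_{H_t}) ∈ ℚ[θ] ⊕ W` (`TensorAnchorDesign.md` §§2–6:
the K-class exists explicitly; semiregularity = pairwise Mumford-index avoidance + one exact injectivity, cap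
`T ≤ 2799`; reduced to ten points of the norm-one torus `K¹` with `p₁ = p₃ = 0 ≠ p₅`), or a genuinely non-split
object at `A₁ × A₁` (Markman's secant sheaves, `n ≤ 3` in print).  WHY IT MIGHT FAIL: no semiregular sheaf with
non-zero Weil charge is known on any abelian variety of dimension `≥ 8` ([Markman2025SecantWeil, §1.2]); the bet is
asked for EVERY `K`-compatible very ample `θ` and EVERY rational direction `x` (designs give a cone of directions per
polarization).  The Weil-PURE sub-case (`q = 0`) is the refuted v2.1 typing and is NOT claimed separately.
[cite: Markman2025SecantWeil, §1.2 and Thm. 1.5.1] [cite: BuchweitzFlenner2003, Def. 4.1 and Thm. 5.1]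
[cite: Perry2026Semiregularity, Def. 2.4 and Thm. 1.1 (2)] -/
theorem stub_tensorAnchorObjectPol :
    ∀ (C : StandardChernCharacterBetti) (Y : AbelianVariety ℂ) (Ψ : Y ⟶ Y) (A₁ : AbelianVariety ℂ)
    (f₁ : Y ⟶ A₁.prod A₁) (g₁ : A₁.prod A₁ ⟶ Y) (m : ℕ),
    A₁.dim = 5 → Y.dim = 10 → Ψ ≫ Ψ = -((11 : ℤ) • 𝟙 Y) → 0 < m → f₁ ≫ g₁ = m • 𝟙 Y →
    AlgebraicGeometry.Flat f₁.hom.hom.hom.left →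
    g₁ ≫ Ψ = AbelianVariety.prodLift (AbelianVariety.snd A₁ A₁ ≫ (-((11 : ℤ) • 𝟙 A₁)))
      (AbelianVariety.fst A₁ A₁) ≫ g₁ →
    ∀ (ι : ProjectiveEmbedding Y.X) (a : complexBetti (projectiveSpace ι.n ℂ) 2), IsRationalClass a → a ≠ 0 →
    ∀ (x : complexBetti Y.X (2 * 5)), IsRationalClass x → IsOfHodgeType 10 Y.X (2 * 5) 5 5 x →
      x ∈ weilClassesOf Y Ψ 5 11 → x ≠ 0 →
    ∀ (F₀ : SchemeOver ℂ) (e₀ : Y.X ≅ F₀),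
      ∃ (E₀ : F₀.left.Modules) (hE₀ : IsFiniteLocallyFree E₀) (q : ℕ → ℚ) (r : ℚ), r ≠ 0 ∧
        IsISemiregular hE₀ Set.univ ∧
        (∀ k : ℕ, k ≠ 5 →
          C.ch F₀ E₀ k = ((q k : ℚ) : ℂ) • complexBetti.map e₀.inv (2 * k)
            (cupPowTwo ((11 : ℂ) • complexBetti.map ι.ι 2 a +
              complexBetti.map Ψ.hom.hom.hom 2 (complexBetti.map ι.ι 2 a)) k)) ∧
        C.ch F₀ E₀ 5 = complexBetti.map e₀.inv (2 * 5)
          (((q 5 : ℚ) : ℂ) • cupPowTwo ((11 : ℂ) • complexBetti.map ι.ι 2 a +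
              complexBetti.map Ψ.hom.hom.hom 2 (complexBetti.map ι.ι 2 a)) 5 + ((r : ℚ) : ℂ) • x) := by
  sorry

/-! ### Name-keyed aliases of the registered statements (hypotheses of the composition BY NAME) -/
namespace Registered

/-- Alias of the route item `DeligneWeilFamily`, keyed by the registered stub name. -/
abbrev stub_deligneWeilFamily : Prop := Summit.HodgeConjecture.HodgeConjecture.Theses.HeckePrymWeil.DeligneWeilFamily
/-- Alias of `Perry2026_semiregularFull_remainsAlgebraic`, keyed by the registered stub name. -/
abbrev stub_semiregularFullVariationalHodge : Prop := type_of% _root_.Summit.HodgeConjecture.HodgeConjecture.Cruxes.WeilTenfoldsSqrtMinus11.QuaternionicNormAnchors.stub_semiregularFullVariationalHodge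
/-- Alias of `Nonempty StandardChernCharacterBetti`, keyed by the registered stub name. -/
abbrev stub_chernCharacterOnBetti : Prop := Nonempty StandardChernCharacterBetti
/-- Alias of the statement of `stub_tensorAnchorObjectPol`, keyed by the registered stub name. -/
abbrev stub_tensorAnchorObjectPol : Prop := type_of% _root_.Summit.HodgeConjecture.HodgeConjecture.Cruxes.WeilTenfoldsSqrtMinus11.QuaternionicNormAnchors.stub_tensorAnchorObjectPol

end Registered

/-! ## §2 The fibrewise-Hodge flat Weil section WITH the total-space `√-p` (package, PROVED) -/

/-- **Deligne's abelian scheme with `K`-action gives the fibrewise-Hodge flat Weil section, the action being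
KEPT** — verbatim `deligne1982_weilFamily_hodgeWeilSection_of_globalAction` (transport along paths from `s₁`
preserves the cohomological Weil planes of the fibres, which the charts identify with the Weil planes of
balanced abelian `2k`-folds), except that the conclusion retains `g : 𝒳 ⟶ 𝒳` over `S` with its intertwining
clauses at every fibre, at `s₁` and at the anchor `s₀` (the consumer builds the global `K`-symmetrised
polarization class `p·Θ + g^*Θ` from it). [cite: Deligne1982HodgeCycles, proof of Thm. 4.8 (pp. 48–51) with Prop. 4.4]
[cite: VoisinHodgeII2003, §3.1.2] -/
theorem hodgeWeilSectionG_of_globalAction (h : deligne1982_weilFamily_globalAction) :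
    ∀ p : ℕ, p.Prime → p % 4 = 3 → 7 ≤ p → ∀ (k : ℕ), 1 ≤ k →
    ∀ (X : AbelianVariety ℂ) (Φ : X ⟶ X), X.dim = 2 * k → Φ ≫ Φ = -((p : ℤ) • 𝟙 X) →
    ∀ c : complexBetti X.X (2 * k), c ∈ weilClassesOf X Φ k p → c ≠ 0 → IsRationalClass c →
      IsOfHodgeType (2 * k) X.X (2 * k) k k c →
      ∃ (𝒳 S : SchemeOver ℂ) (f : 𝒳 ⟶ S) (g : 𝒳 ⟶ 𝒳) (s₁ s₀ : ComplexPoints S)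
        (e : X.X ≅ fiberOver f s₁) (σ : ComplexPoints S → FiberClass f (2 * k)),
        IsSmoothProjectiveFamily f (2 * k) ∧
        (∃ (N : ℕ) (ι : 𝒳 ⟶ projectiveSpace N ℂ ⊗ S),
            IsClosedImmersion ι.left ∧ ι ≫ snd (projectiveSpace N ℂ) S = f) ∧
        IrreducibleSpace S.left ∧ AlgebraicGeometry.Smooth S.hom ∧ IsQuasiProjectiveOver S ∧
        g ≫ f = f ∧
        (∀ s : ComplexPoints S, ∃ (A' : AbelianVariety ℂ) (φ' : A' ⟶ A') (e' : A'.X ≅ fiberOver f s),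
          A'.dim = 2 * k ∧ φ' ≫ φ' = -((p : ℤ) • 𝟙 A') ∧
          (e'.hom ≫ fiberι f s) ≫ g = φ'.hom.hom.hom ≫ (e'.hom ≫ fiberι f s)) ∧
        (e.hom ≫ fiberι f s₁) ≫ g = Φ.hom.hom.hom ≫ (e.hom ≫ fiberι f s₁) ∧
        Continuous σ ∧ (∀ s, (σ s).pt = s) ∧
        (∀ s, IsOfHodgeType (2 * k) (fiberOver f (σ s).pt) (2 * k) k k (σ s).cls) ∧
        σ s₁ = ⟨s₁, complexBetti.map e.inv (2 * k) c⟩ ∧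
        ∃ (Y : AbelianVariety ℂ) (Ψ : Y ⟶ Y) (e₀ : Y.X ≅ fiberOver f s₀)
          (x : complexBetti (fiberOver f s₀) (2 * k)),
          (∃ (A₁ : AbelianVariety ℂ) (f₁ : Y ⟶ A₁.prod A₁) (g₁ : A₁.prod A₁ ⟶ Y) (m : ℕ),
            A₁.dim = k ∧ Y.dim = 2 * k ∧ Ψ ≫ Ψ = -((p : ℤ) • 𝟙 Y) ∧ 0 < m ∧
            f₁ ≫ g₁ = m • 𝟙 Y ∧ Flat f₁.hom.hom.hom.left ∧
            g₁ ≫ Ψ = AbelianVariety.prodLift (AbelianVariety.snd A₁ A₁ ≫ (-((p : ℤ) • 𝟙 A₁)))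
              (AbelianVariety.fst A₁ A₁) ≫ g₁) ∧
          (e₀.hom ≫ fiberι f s₀) ≫ g = Ψ.hom.hom.hom ≫ (e₀.hom ≫ fiberι f s₀) ∧
          σ s₀ = ⟨s₀, x⟩ ∧ complexBetti.map e₀.hom (2 * k) x ∈ weilClassesOf Y Ψ k p := by
  intro p hp hp4 hp7 k hk X Φ hX hΦ c hc hc0 hrat hH
  obtain ⟨𝒳, S, f, g, s₁, s₀, e, σ, hfam, hemb, hirr, hsm, hSqp, hg, hfib, he, hσ, hpt, hσ₁, Y, Ψ,
    e₀, hiso, he₀⟩ := h p hp hp4 hp7 k hk X Φ hX hΦ c hc hc0 hrat hH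
  have hp0 : 0 < p := hp.pos
  -- the base: `S(ℂ)` is a path-connected manifold and `R^{2k} f_* ℂ` is a local system on it
  haveI := hsm
  haveI := hirr
  haveI : LocallyOfFiniteType S.hom := hSqp.locallyOfFiniteType
  haveI : ConnectedSpace (ComplexPoints S) :=
    (Motives.ComplexPoints.connectedSpace_iff_holds S).2 inferInstance
  obtain ⟨d, hd⟩ := exists_smoothOfRelativeDimension_of_connectedSpace_complexPoints S
  haveI := hd
  haveI := pathConnectedSpace_complexPoints_of_smoothOfRelativeDimension S d
  have hU := isCohomologicallyLocallyTrivialOn_univ_of_isSmoothProjectiveFamily f d hfam hSqp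
  -- the fibre maps of `g`
  have hgf' := fun t ↦ exists_fiberHom_comp_fiberι f g hg t
  choose gf hgf using hgf'
  -- the cohomological Weil plane of the fibre over `t`
  let WP : ∀ t : ComplexPoints S, Submodule ℂ (complexBetti (fiberOver f t) (2 * k)) :=
    fun t ↦
      Submodule.span ℂ
        {x | ∃ w : Fin (2 * k) → complexBetti (fiberOver f t) 1,
          (∀ i, w i ∈ Module.End.eigenspace (complexBetti.map (gf t) 1).hom
            (Complex.I * (Real.sqrt p : ℂ))) ∧
          cupPowOne ℂ (ComplexPoints (fiberOver f t)) (2 * k) w = x} ⊔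
      Submodule.span ℂ
        {x | ∃ w : Fin (2 * k) → complexBetti (fiberOver f t) 1,
          (∀ i, w i ∈ Module.End.eigenspace (complexBetti.map (gf t) 1).hom
            (-(Complex.I * (Real.sqrt p : ℂ)))) ∧
          cupPowOne ℂ (ComplexPoints (fiberOver f t)) (2 * k) w = x}
  -- at `s₁`: `e^{-1 *} c` lies in the Weil plane of `(𝒳_{s₁}, g_{s₁})`
  have hΦ' : Φ ≫ Φ = -(p • 𝟙 X) := by rw [hΦ, natCast_zsmul]
  have he' : e.hom ≫ gf s₁ = Φ.hom.hom.hom ≫ e.hom :=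
    hom_comp_fiberHom_eq_of_comp_fiberι f g (hgf s₁) e Φ.hom.hom.hom he
  have h₁ : complexBetti.map e.inv (2 * k) c ∈ WP s₁ :=
    map_inv_mem_eigenLines_of_mem_weilClassesOf e (gf s₁) hp0 hX hΦ' he' hc
  -- transport from `s₁`: every value of `σ` lies in the Weil plane of its fibre
  have key : ∀ (s t : ComplexPoints S) (hst : (σ s).pt = t), (σ s).clsAt hst ∈ WP t := by
    intro s t hst
    obtain rfl : s = t := (hpt s).symm.trans hst
    let γ : Path (⟨s₁, Set.mem_univ s₁⟩ : (Set.univ : Set (ComplexPoints S))) ⟨s, Set.mem_univ s⟩ :=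
      (PathConnectedSpace.somePath s₁ s).map (continuous_id.subtype_mk _)
    have htr := transportFun_clsAt_of_continuous f (2 * k) hU hσ hpt γ
    have h0 : (σ s₁).clsAt (hpt s₁) = complexBetti.map e.inv (2 * k) c := by
      rw [FiberClass.clsAt_eq_iff]; exact hσ₁
    change transportFun f (2 * k) hU ⟦γ⟧ ((σ s₁).clsAt (hpt s₁)) = (σ s).clsAt (hpt s) at htr
    rw [← htr, h0]
    exact transportFun_mem_eigenLines f hU g hg gf hgf ⟦γ⟧ _ _ (2 * k) h₁
  refine ⟨𝒳, S, f, g, s₁, s₀, e, σ, hfam, hemb, hirr, hsm, hSqp, hg, fun s ↦ ?_, he, hσ, hpt, fun s ↦ ?_,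
    hσ₁, Y, Ψ, e₀, (σ s₀).clsAt (hpt s₀), hiso, he₀, (FiberClass.mk_clsAt _ _).symm, ?_⟩
  · -- every fibre is an abelian `2k`-fold with `√-p`, charts intertwining `g`
    obtain ⟨A', φ', e', hA', hφ', he'c, -⟩ := hfib s
    exact ⟨A', φ', e', hA', hφ', he'c⟩
  · -- the values of `σ` are of Hodge type `(k,k)`: read in the chart of clause (a)
    obtain ⟨A', φ', e', hA', hφ', he'c, hbal⟩ := hfib (σ s).pt
    have hmem : (σ s).cls ∈ WP (σ s).pt := key s (σ s).pt rfl
    have he'' : e'.hom ≫ gf (σ s).pt = φ'.hom.hom.hom ≫ e'.hom :=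
      hom_comp_fiberHom_eq_of_comp_fiberι f g (hgf _) e' φ'.hom.hom.hom he'c
    have hA'mem : complexBetti.map e'.hom (2 * k) (σ s).cls ∈ weilClassesOf A' φ' k p :=
      map_mem_weilClassesOf_of_mem_eigenLines e' (gf _) he'' hmem
    have htyp := (hbal _ hA'mem).map_of_iso e'.symm
    have hid : singularCohomology.map ℂ ℂ (Motives.AlgPoints.mapContinuous (L := ℂ) e'.symm.hom) (2 * k)
        (complexBetti.map e'.hom (2 * k) (σ s).cls) = (σ s).cls := by
      change complexBetti.map e'.inv (2 * k) (complexBetti.map e'.hom (2 * k) (σ s).cls) = _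
      rw [← ModuleCat.comp_apply, ← complexBetti.map_comp, e'.inv_hom_id, complexBetti.map_id]
      rfl
    rw [hid] at htyp
    exact htyp
  · -- at `s₀`: the value lies in the strong Weil plane of `(Y, Ψ)`
    have he₀' : e₀.hom ≫ gf s₀ = Ψ.hom.hom.hom ≫ e₀.hom :=
      hom_comp_fiberHom_eq_of_comp_fiberι f g (hgf s₀) e₀ Ψ.hom.hom.hom he₀
    exact map_mem_weilClassesOf_of_mem_eigenLines e₀ (gf s₀) he₀' (key s₀ s₀ (hpt s₀))


/-! ## §3 Infrastructure and the engine (copies of the sibling's `AnchorObject` lemmas, crux 14642, general `n`) -/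

/-- Naturality of cup powers for pull-backs along scheme morphisms: `g^*(x^i) = (g^*x)^i`.
[cite: HatcherAT2002, Prop. 3.10] -/
theorem qna_complexBetti_map_cupPowTwo {X' X : SchemeOver ℂ} (g : X' ⟶ X) (x : complexBetti X 2) (i : ℕ) :
    complexBetti.map g (2 * i) (cupPowTwo x i) = cupPowTwo (complexBetti.map g 2 x) i :=
  map_cupPowTwo _ x i

/-- **Powers of divisor classes on an abelian variety are algebraic**: `x ∈ N¹H² ⟹ x^{i+1} ∈ N^{i+1}H^{2i+2}`
(Kleiman moving by translations — the tree's `AbelianVariety.cupProduct_mem_algebraicClasses_one` — iterated).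
[cite: VoisinHodgeII2003, §9.2.4 Prop. 9.20] -/
theorem qna_cupPowTwo_mem_algebraicClasses_abelian (A : AbelianVariety ℂ) {x : complexBetti A.X 2}
    (hx : x ∈ algebraicClasses A.X 1) : ∀ i : ℕ, cupPowTwo x (i + 1) ∈ algebraicClasses A.X (i + 1)
  | 0 => by rw [cupPowTwo_one]; exact hx
  | i + 1 => by
    rw [cupPowTwo_succ]
    exact AbelianVariety.cupProduct_mem_algebraicClasses_one A (qna_cupPowTwo_mem_algebraicClasses_abelian A hx i) hx

/-- **ENGINE (Perry ⟹ the impure Weil section is algebraic on EVERY fibre)** — the sibling's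
`AnchorObject.engine_of_perry` (crux 14642), general `n`, same proof.  Along a smooth projective family
`f : 𝒳 ⟶ S` of relative dimension `2n` over a smooth irreducible quasi-projective base, let `H ∈ H²(𝒳)` have
rational `(1,1)` restrictions and `W ∈ H^{2n}(𝒳)` rational `(n,n)` restrictions.  If at ONE point `s₀` there is a
finite locally free SEMIREGULAR `E₀` on the fibre with `ch_k(E₀) = q_k·H_{s₀}^k` (`k ≠ n`) and
`ch_n(E₀) = q_n·H_{s₀}^n + W_{s₀}` in some Chern character theory `C`, then `q_n·H_s^n + W_s` is ALGEBRAIC on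
`𝒳_s` for EVERY `s`: Perry's theorem applied to the family of sections `s ↦ (q_k·H^k + [k = n]·W)|_{𝒳_s}` —
continuous because they are restrictions of GLOBAL classes, valued in the locus of Hodge classes, equal to
`ch(E₀)` at `s₀`. [cite: Perry2026Semiregularity, Thm. 1.1 (2)] [cite: BuchweitzFlenner2003, Thm. 5.1] -/
theorem qna_engine_of_perry (hP : Perry2026_semiregularFull_remainsAlgebraic) (n : ℕ)
    {𝒳 S : SchemeOver ℂ} (f : 𝒳 ⟶ S) (hf : IsSmoothProjectiveFamily f (2 * n))
    (hirr : IrreducibleSpace S.left) (hS : AlgebraicGeometry.Smooth S.hom) (hSqp : IsQuasiProjectiveOver S)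
    (H : complexBetti 𝒳 2)
    (hH : ∀ s, IsRationalClass (complexBetti.map (fiberι f s) 2 H) ∧
      IsOfHodgeType (2 * n) (fiberOver f s) 2 1 1 (complexBetti.map (fiberι f s) 2 H))
    (W : complexBetti 𝒳 (2 * n))
    (hWrat : ∀ s, IsRationalClass (complexBetti.map (fiberι f s) (2 * n) W))
    (hWH : ∀ s, IsOfHodgeType (2 * n) (fiberOver f s) (2 * n) n n (complexBetti.map (fiberι f s) (2 * n) W))
    (s₀ : ComplexPoints S) (C : ChernCharacterBetti) (E₀ : (fiberOver f s₀).left.Modules)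
    (hE₀ : IsFiniteLocallyFree E₀) (hsr : IsISemiregular hE₀ Set.univ) (q : ℕ → ℚ)
    (hk : ∀ k : ℕ, k ≠ n →
      C.ch (fiberOver f s₀) E₀ k = ((q k : ℚ) : ℂ) • cupPowTwo (complexBetti.map (fiberι f s₀) 2 H) k)
    (hn : C.ch (fiberOver f s₀) E₀ n =
      ((q n : ℚ) : ℂ) • cupPowTwo (complexBetti.map (fiberι f s₀) 2 H) n +
        complexBetti.map (fiberι f s₀) (2 * n) W) :
    ∀ s : ComplexPoints S,
      ((q n : ℚ) : ℂ) • cupPowTwo (complexBetti.map (fiberι f s) 2 H) n +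
          complexBetti.map (fiberι f s) (2 * n) W ∈ algebraicClasses (fiberOver f s) n := by
  intro s
  haveI := hS
  haveI := hirr
  haveI : IsReduced S.left := isReduced_of_smooth_over_field S.hom
  have hint : IsIntegral S.left := isIntegral_of_irreducibleSpace_of_isReduced _
  -- the global classes `A k = q_k • H^k + [k = n] • W` on the total space
  let A : ∀ k : ℕ, complexBetti 𝒳 (2 * k) := fun k =>
    if h : k = n then ((q k : ℚ) : ℂ) • cupPowTwo H k + h ▸ W else ((q k : ℚ) : ℂ) • cupPowTwo H k
  have hAn : A n = ((q n : ℚ) : ℂ) • cupPowTwo H n + W := by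
    show (if h : n = n then _ else _) = _
    rw [dif_pos rfl]
  have hAk : ∀ k, k ≠ n → A k = ((q k : ℚ) : ℂ) • cupPowTwo H k := by
    intro k hk'
    show (if h : k = n then _ else _) = _
    rw [dif_neg hk']
  -- restrictions of the global classes to the fibres
  have hres : ∀ k s, complexBetti.map (fiberι f s) (2 * k) (((q k : ℚ) : ℂ) • cupPowTwo H k) =
      ((q k : ℚ) : ℂ) • cupPowTwo (complexBetti.map (fiberι f s) 2 H) k := by
    intro k s
    rw [map_smul, qna_complexBetti_map_cupPowTwo]
  have hresn : ∀ s, complexBetti.map (fiberι f s) (2 * n) (A n) =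
      ((q n : ℚ) : ℂ) • cupPowTwo (complexBetti.map (fiberι f s) 2 H) n +
        complexBetti.map (fiberι f s) (2 * n) W := by
    intro s
    rw [hAn, map_add, hres n s]
  -- the family of sections (fibre restrictions of the `A k`)
  let w : ∀ (k : ℕ) (s : ComplexPoints S), complexBetti (fiberOver f s) (2 * k) :=
    fun k s => complexBetti.map (fiberι f s) (2 * k) (A k)
  -- continuity: they ARE global sections
  have hwc : ∀ k, Continuous fun s => (⟨s, w k s⟩ : FiberClass f (2 * k)) := fun k =>
    continuous_globalSection f (2 * k) (A k)
  -- values in the locus of Hodge classes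
  have hwH : ∀ k s, (⟨s, w k s⟩ : FiberClass f (2 * k)) ∈ locusOfHodgeClasses f (2 * n) k := by
    intro k s
    rw [mem_locusOfHodgeClasses_iff]
    by_cases hkn : k = n
    · subst hkn
      show IsRationalClass (complexBetti.map (fiberι f s) (2 * k) (A k)) ∧
        IsOfHodgeType (2 * k) (fiberOver f s) (2 * k) k k (complexBetti.map (fiberι f s) (2 * k) (A k))
      rw [hresn s]
      refine ⟨?_, ?_⟩
      · exact (((hH s).1.cupPowTwo k).smul (q k)).add (hWrat s)
      · exact ((isOfHodgeType_cupPowTwo (hf.isSmoothProjective s) (hH s).2 k).smul _).add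
          (hf.isSmoothProjective s) (hWH s)
    · show IsRationalClass (complexBetti.map (fiberι f s) (2 * k) (A k)) ∧
        IsOfHodgeType (2 * n) (fiberOver f s) (2 * k) k k (complexBetti.map (fiberι f s) (2 * k) (A k))
      rw [hAk k hkn, hres k s]
      exact ⟨((hH s).1.cupPowTwo k).smul (q k),
        (isOfHodgeType_cupPowTwo (hf.isSmoothProjective s) (hH s).2 k).smul _⟩
  -- the values at `s₀` are the Chern character of `E₀`
  have hw₀ : ∀ k, w k s₀ = C.ch (fiberOver f s₀) E₀ k := by
    intro k
    by_cases hkn : k = n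
    · subst hkn
      show complexBetti.map (fiberι f s₀) (2 * k) (A k) = _
      rw [hresn s₀, hn]
    · show complexBetti.map (fiberι f s₀) (2 * k) (A k) = _
      rw [hAk k hkn, hres k s₀, hk k hkn]
  -- Perry
  have h := hP C f (2 * n) hf hSqp hint hS w hwc hwH s₀ E₀ hE₀ hsr hw₀ s n
  have h' : w n s = ((q n : ℚ) : ℂ) • cupPowTwo (complexBetti.map (fiberι f s) 2 H) n +
      complexBetti.map (fiberι f s) (2 * n) W := hresn s
  rwa [h'] at h

/-! ## §4 The composition: the registered stubs imply the crux, BY NAME (no `sorry` of its own) -/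

/-- **`WeilTenfoldsSqrtMinus11` from the four OPEN stubs F, P, C, B** (v3: F = the route item, B polarised; the same
statement is landed as `Theorems/…TensorAnchorPerryPol.stub_perryRouteCompositionPol`).  See the module docstring,
MECHANISM. [cite: Deligne1982HodgeCycles, proof of Thm. 4.8 (pp. 47–52) with Prop. 4.4]
[cite: Perry2026Semiregularity, Thm. 1.1 (2)] [cite: VoisinHodgeII2003, Thm. 4.18 and §9.2.4 Prop. 9.20] -/
theorem WeilTenfoldsSqrtMinus11_of
    (hF : Registered.stub_deligneWeilFamily) (hP : Registered.stub_semiregularFullVariationalHodge)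
    (hC : Registered.stub_chernCharacterOnBetti) (hB : Registered.stub_tensorAnchorObjectPol) :
    Summit.HodgeConjecture.HodgeConjecture.Theses.HeckePrymWeil.WeilTenfoldsSqrtMinus11 := by
  intro A φ hA hφ c hr hH hW
  by_cases hc : c = 0
  · rw [hc]
    exact Submodule.zero_mem _
  -- casts: the packages are stated for a variable prime `p`, here `p = 11`, at degree `2 * 5`
  have hφ' : φ ≫ φ = -(((11 : ℕ) : ℤ) • 𝟙 A) := by exact_mod_cast hφ
  have hA' : A.dim = 2 * 5 := hA
  -- typing upgrade (landed): the single-operator plane lies in the strong Weil plane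
  have hcW : c ∈ weilClassesOf A φ 5 11 := by
    refine stub_upgrade 11 (by norm_num) (by norm_num) (by norm_num) 5 A φ hA' hφ' ?_
    exact_mod_cast hW
  -- the route item, as the abelian scheme with `K`-action (landed equivalences), with the action KEPT
  have hK : deligne1982_weilFamily_kAction := deligneWeilFamilyDecl_iff_kAction.mp hF
  have hG : deligne1982_weilFamily_globalAction := deligne1982_weilFamily_globalAction_of_kAction hK
  obtain ⟨𝒳, S, f, g, s₁, s₀, e, σ, hfam, hemb, hirr, hsm, hSqp, hg, hfib, he, hσc, hpt, hHσ, hs₁, Y, Ψ,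
    e₀, x, ⟨A₁, f₁, g₁, m, hA₁, hY, hΨ, hm, hfg, hf₁, hg₁⟩, he₀, hs₀, hx⟩ :=
    hodgeWeilSectionG_of_globalAction hG 11 (by norm_num) (by norm_num) (by norm_num) 5 (by norm_num) A φ hA'
      hφ' c hcW hc hr hH
  -- rationality along the section (landed)
  have hrat₁ : IsRationalClass (σ s₁).cls := by
    rw [hs₁]; exact hr.map _
  have hratσ : ∀ s, IsRationalClass (σ s).cls :=
    stub_rationalAlongSection f (2 * 5) (2 * 5) hfam hsm hSqp hirr σ hσc hpt s₁ hrat₁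
  have hratx : IsRationalClass x := by
    have h := hratσ s₀
    rwa [hs₀] at h
  have hHx : IsOfHodgeType 10 (fiberOver f s₀) (2 * 5) 5 5 x := by
    have h := hHσ s₀
    rw [hs₀] at h
    exact h
  -- the base is a connected manifold; `R• f_* ℂ` is a local system on it
  haveI := hsm
  haveI := hirr
  haveI : LocallyOfFiniteType S.hom := hSqp.locallyOfFiniteType
  haveI : ConnectedSpace (ComplexPoints S) :=
    (ComplexPoints.connectedSpace_iff_holds S).2 inferInstance
  obtain ⟨dS, hdS⟩ := exists_smoothOfRelativeDimension_of_connectedSpace_complexPoints S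
  haveI := hdS
  haveI := pathConnectedSpace_complexPoints_of_smoothOfRelativeDimension S dS
  have hU := isCohomologicallyLocallyTrivialOn_univ_of_isSmoothProjectiveFamily f dS hfam hSqp
  -- `x ≠ 0`: a continuous section vanishing at `s₀` vanishes identically (identity principle, landed)
  have hx0 : x ≠ 0 := by
    intro hx0
    have hzero : σ s₀ = globalSection f (2 * 5) 0 s₀ := by
      rw [hs₀, hx0]
      show (⟨s₀, 0⟩ : FiberClass f (2 * 5)) = ⟨s₀, _⟩
      rw [map_zero]
    have hall := gcs_section_eq_of_eq f (2 * 5) hU hσc hpt (continuous_globalSection f _ 0)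
      (fun _ => rfl) hzero s₁
    rw [hs₁] at hall
    have hc' : complexBetti.map e.inv (2 * 5) c = 0 := by
      have h2 := ((FiberClass.clsAt_eq_iff _ rfl _).2 hall.symm).symm
      rw [h2]
      show complexBetti.map (fiberι f s₁) (2 * 5) 0 = 0
      rw [map_zero]
    apply hc
    have h3 := congrArg (complexBetti.map e.hom (2 * 5)) hc'
    rwa [map_zero, ← CategoryTheory.comp_apply, ← complexBetti.map_comp, Iso.hom_inv_id,
      complexBetti.map_id, CategoryTheory.id_apply] at h3
  -- the PROVED Leray engine: `σ` is the restriction of a global class `W`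
  obtain ⟨W, hWσ⟩ := stub_globalClassOfSection_of_leray deligne1968_invariantClass_fromTotalSpace_holds f (2 * 5)
    (2 * 5) hfam hemb hsm hSqp hirr σ hσc hpt
  have hcls : ∀ (s : ComplexPoints S) (y : complexBetti (fiberOver f s) (2 * 5)),
      σ s = ⟨s, y⟩ → complexBetti.map (fiberι f s) (2 * 5) W = y := by
    intro s y hy
    have h := (hWσ s).symm.trans hy
    simp only [globalSection, FiberClass.mk.injEq, heq_eq_eq, true_and] at h
    exact h
  have hW₁ : complexBetti.map (fiberι f s₁) (2 * 5) W = complexBetti.map e.inv (2 * 5) c := hcls s₁ _ hs₁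
  have hW₀ : complexBetti.map (fiberι f s₀) (2 * 5) W = x := hcls s₀ x hs₀
  have hWrat : ∀ s, IsRationalClass (complexBetti.map (fiberι f s) (2 * 5) W) := by
    intro s
    have h := hratσ s
    rw [hWσ s] at h
    exact h
  have hWH : ∀ s, IsOfHodgeType (2 * 5) (fiberOver f s) (2 * 5) 5 5 (complexBetti.map (fiberι f s) (2 * 5) W) := by
    intro s
    have h := hHσ s
    rw [hWσ s] at h
    exact h
  -- the fibre maps of `g`
  have hgf' := fun t ↦ exists_fiberHom_comp_fiberι f g hg t
  choose gf hgf using hgf'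
  -- all fibres embed in ONE projective space `ℙᵐ`, `m ≥ 10`
  obtain ⟨mm, ε, hε⟩ := exists_forall_isClosedImmersion_fiberι_comp f hfam hemb hSqp
  have hPm : IsSmoothProjective mm (projectiveSpace mm ℂ) := isSmoothProjective_projectiveSpace' mm
  have hmm : 1 ≤ mm := by
    haveI := hε s₀
    obtain ⟨B⟩ := (nonempty_hodgeModel_holds (n := 2 * 5) (X := fiberOver f s₀)).nonempty
      (hfam.isSmoothProjective s₀)
    obtain ⟨Bm⟩ := (nonempty_hodgeModel_holds (n := mm) (X := projectiveSpace mm ℂ)).nonempty hPm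
    have h := dim_le_of_isClosedImmersion_projectiveSpace (hfam.isSmoothProjective s₀) (fiberι f s₀ ≫ ε) B Bm
    omega
  obtain ⟨a, ha, ha0⟩ := exists_isRationalClass_ne_zero_projectiveSpace hmm
  have ha11 : IsOfHodgeType mm (projectiveSpace mm ℂ) (2 * 1) 1 1 a :=
    isOfHodgeType_of_mem_algebraicClasses_of_isSmoothProjective hPm 1
      (by rw [algebraicClasses_projectiveSpace_eq_top]; exact Submodule.mem_top)
  -- the GLOBAL `K`-symmetrised hyperplane class `Θ_K = 11·ε^*a + g^*ε^*a` and its fibre restrictions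
  set Θ : complexBetti 𝒳 2 := complexBetti.map ε 2 a with hΘdef
  set ΘK : complexBetti 𝒳 2 := (11 : ℂ) • Θ + complexBetti.map g 2 Θ with hΘKdef
  -- `θ_s := ι_s^* Θ = (ι_s ≫ ε)^* a`
  have hθs : ∀ s, complexBetti.map (fiberι f s) 2 Θ = complexBetti.map (fiberι f s ≫ ε) 2 a := by
    intro s
    rw [hΘdef, complexBetti.map_comp, ModuleCat.comp_apply]
  have hΘKs : ∀ s, complexBetti.map (fiberι f s) 2 ΘK =
      (11 : ℂ) • complexBetti.map (fiberι f s) 2 Θ +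
        complexBetti.map (gf s) 2 (complexBetti.map (fiberι f s) 2 Θ) := by
    intro s
    rw [hΘKdef, map_add, map_smul, ← ModuleCat.comp_apply (complexBetti.map g 2),
      ← complexBetti.map_comp, ← hgf s, complexBetti.map_comp, ModuleCat.comp_apply]
  -- `Θ_K|_{𝒳_s}` is rational of type `(1,1)` on every fibre
  have hΘKfib : ∀ s, IsRationalClass (complexBetti.map (fiberι f s) 2 ΘK) ∧
      IsOfHodgeType (2 * 5) (fiberOver f s) 2 1 1 (complexBetti.map (fiberι f s) 2 ΘK) := by
    intro s
    have hsp := hfam.isSmoothProjective s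
    have hrat' : IsRationalClass (complexBetti.map (fiberι f s) 2 Θ) := by
      rw [hθs s]; exact ha.map _
    have h11' : IsOfHodgeType (2 * 5) (fiberOver f s) 2 1 1 (complexBetti.map (fiberι f s) 2 Θ) := by
      rw [hθs s]; exact ha11.map_of_isSmoothProjective hsp hPm _
    rw [hΘKs s]
    refine ⟨?_, (h11'.smul _).add hsp (h11'.map_of_isSmoothProjective hsp hsp _)⟩
    have h11 : ((11 : ℚ) : ℂ) • complexBetti.map (fiberι f s) 2 Θ = (11 : ℂ) • complexBetti.map (fiberι f s) 2 Θ := by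
      norm_num
    rw [← h11]
    exact (hrat'.smul 11).add (hrat'.map _)
  -- the anchor's embedding `Y ≅ 𝒳_{s₀} ↪ ℙᵐ` and the bet's `K`-symmetrised class `θ` through `e₀`
  haveI : IsIso e₀.hom.left :=
    ⟨e₀.inv.left, by rw [← Over.comp_left, e₀.hom_inv_id, Over.id_left],
      by rw [← Over.comp_left, e₀.inv_hom_id, Over.id_left]⟩
  haveI := hε s₀
  haveI : IsClosedImmersion (e₀.hom ≫ (fiberι f s₀ ≫ ε)).left := by
    rw [Over.comp_left]
    infer_instance
  let ιY : ProjectiveEmbedding Y.X := ⟨mm, e₀.hom ≫ (fiberι f s₀ ≫ ε), inferInstance⟩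
  have he₀' : e₀.hom ≫ gf s₀ = Ψ.hom.hom.hom ≫ e₀.hom :=
    hom_comp_fiberHom_eq_of_comp_fiberι f g (hgf s₀) e₀ Ψ.hom.hom.hom he₀
  have hιa : complexBetti.map ιY.ι 2 a = complexBetti.map e₀.hom 2 (complexBetti.map (fiberι f s₀) 2 Θ) := by
    show complexBetti.map (e₀.hom ≫ (fiberι f s₀ ≫ ε)) 2 a = _
    rw [complexBetti.map_comp, ModuleCat.comp_apply, hθs s₀]
  have hθY : complexBetti.map e₀.inv 2
      ((11 : ℂ) • complexBetti.map ιY.ι 2 a + complexBetti.map Ψ.hom.hom.hom 2 (complexBetti.map ιY.ι 2 a)) =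
      complexBetti.map (fiberι f s₀) 2 ΘK := by
    rw [hιa, map_add, map_smul, e₀.complexBetti_map_inv_map_hom, hΘKs s₀]
    congr 1
    rw [← ModuleCat.comp_apply (complexBetti.map e₀.hom 2), ← complexBetti.map_comp,
      ← ModuleCat.comp_apply (complexBetti.map (Ψ.hom.hom.hom ≫ e₀.hom) 2), ← complexBetti.map_comp,
      ← he₀', e₀.inv_hom_id_assoc]
  -- the Weil class read on `Y`
  have hxY0 : complexBetti.map e₀.hom (2 * 5) x ≠ 0 := by
    intro h0
    apply hx0
    have h3 := congrArg (complexBetti.map e₀.inv (2 * 5)) h0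
    rwa [map_zero, e₀.complexBetti_map_inv_map_hom] at h3
  have hxYH : IsOfHodgeType 10 Y.X (2 * 5) 5 5 (complexBetti.map e₀.hom (2 * 5) x) := hHx.map_of_iso e₀
  -- STUB C: a standard Chern character; STUB B: the polarised semiregular object on `𝒳_{s₀} ≅ Y`
  obtain ⟨C⟩ := hC
  obtain ⟨E₀, hE₀, q, r, hr0, hsr, hEk, hE5⟩ :=
    hB C Y Ψ A₁ f₁ g₁ m hA₁ hY (by exact_mod_cast hΨ) hm hfg hf₁ (by exact_mod_cast hg₁) ιY a ha ha0
      (complexBetti.map e₀.hom (2 * 5) x) (hratx.map _) hxYH hx hxY0 (fiberOver f s₀) e₀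
  have hrC : ((r : ℚ) : ℂ) ≠ 0 := by exact_mod_cast hr0
  -- the Chern character of `E₀` in terms of the GLOBAL classes `Θ_K`, `r • W`
  have hk : ∀ k : ℕ, k ≠ 5 →
      C.ch (fiberOver f s₀) E₀ k = ((q k : ℚ) : ℂ) • cupPowTwo (complexBetti.map (fiberι f s₀) 2 ΘK) k := by
    intro k hk5
    rw [hEk k hk5, qna_complexBetti_map_cupPowTwo, hθY]
  have hWrat' : ∀ s, IsRationalClass (complexBetti.map (fiberι f s) (2 * 5) (((r : ℚ) : ℂ) • W)) := by
    intro s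
    rw [map_smul]
    exact (hWrat s).smul r
  have hWH' : ∀ s, IsOfHodgeType (2 * 5) (fiberOver f s) (2 * 5) 5 5
      (complexBetti.map (fiberι f s) (2 * 5) (((r : ℚ) : ℂ) • W)) := by
    intro s
    rw [map_smul]
    exact (hWH s).smul _
  have hn : C.ch (fiberOver f s₀) E₀ 5 =
      ((q 5 : ℚ) : ℂ) • cupPowTwo (complexBetti.map (fiberι f s₀) 2 ΘK) 5 +
        complexBetti.map (fiberι f s₀) (2 * 5) (((r : ℚ) : ℂ) • W) := by
    rw [hE5, map_add, map_smul, map_smul, qna_complexBetti_map_cupPowTwo, hθY, e₀.complexBetti_map_inv_map_hom,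
      map_smul, hW₀]
  -- STUB P through the engine: `q₅·Θ_K|_{s₁}⁵ + r·W|_{s₁}` is algebraic on `𝒳_{s₁}`
  have halg := qna_engine_of_perry hP 5 f hfam hirr hsm hSqp ΘK hΘKfib (((r : ℚ) : ℂ) • W) hWrat' hWH' s₀
    C.toChernCharacterBetti E₀ hE₀ hsr q hk hn s₁
  -- `Θ_K|_{s₁}⁵` is algebraic on `𝒳_{s₁}`: Lefschetz (1,1) (discharged) + Kleiman on the abelian `A ≅ 𝒳_{s₁}`
  have hAsp : IsSmoothProjective (2 * 5) A.X := by
    have h := AbelianVariety.isSmoothProjective_holds (A := A)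
    rw [AbelianVariety.isSmoothProjective, hA'] at h
    exact h
  have hh₁rat : IsRationalClass (complexBetti.map e.hom 2 (complexBetti.map (fiberι f s₁) 2 ΘK)) :=
    (hΘKfib s₁).1.map _
  have hh₁H : IsOfHodgeType (2 * 5) A.X 2 1 1 (complexBetti.map e.hom 2 (complexBetti.map (fiberι f s₁) 2 ΘK)) :=
    (hΘKfib s₁).2.map_of_iso e
  have hh₁alg : complexBetti.map e.hom 2 (complexBetti.map (fiberι f s₁) 2 ΘK) ∈ algebraicClasses A.X 1 :=
    lefschetzOneOne_rational_holds hAsp _ hh₁rat hh₁H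
  have hh₁5 : complexBetti.map e.hom (2 * 5) (cupPowTwo (complexBetti.map (fiberι f s₁) 2 ΘK) 5) ∈
      algebraicClasses A.X 5 := by
    rw [qna_complexBetti_map_cupPowTwo]
    exact qna_cupPowTwo_mem_algebraicClasses_abelian A hh₁alg 4
  have hΘ5 : cupPowTwo (complexBetti.map (fiberι f s₁) 2 ΘK) 5 ∈ algebraicClasses (fiberOver f s₁) 5 :=
    owf_isoTransport _ A e 5 _ hh₁5
  -- hence `r • W_{s₁} = r • e^{-1*} c`, and so `e^{-1*} c` (`r ≠ 0`), is algebraic on `𝒳_{s₁}`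
  have hrW₁alg : ((r : ℚ) : ℂ) • complexBetti.map e.inv (2 * 5) c ∈ algebraicClasses (fiberOver f s₁) 5 := by
    rw [← hW₁, ← map_smul]
    have h := Submodule.sub_mem _ halg (Submodule.smul_mem _ (((q 5 : ℚ) : ℂ)) hΘ5)
    rwa [add_sub_cancel_left] at h
  have h1 : complexBetti.map e.inv (2 * 5) c ∈ algebraicClasses (fiberOver f s₁) 5 :=
    (Submodule.smul_mem_iff _ hrC).mp hrW₁alg
  -- back along `e : A ≅ 𝒳_{s₁}` (the route's proved `IsoInvariance`)
  have key := Theorems.isoInvariance_proof e 5 _ h1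
  rw [← CategoryTheory.comp_apply, ← complexBetti.map_comp, Iso.hom_inv_id, complexBetti.map_id] at key
  exact key


/-- Wiring check: the registered stubs feed `WeilTenfoldsSqrtMinus11_of` as stated. -/
example : Summit.HodgeConjecture.HodgeConjecture.Theses.HeckePrymWeil.WeilTenfoldsSqrtMinus11 :=
  WeilTenfoldsSqrtMinus11_of stub_deligneWeilFamily stub_semiregularFullVariationalHodge
    stub_chernCharacterOnBetti stub_tensorAnchorObjectPol

/-! ## §5 The engine-agnostic residue, PROVED: crux ⟸ two accepted named facts + `WeilVariationalHodge (11,5)` -/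

/-- **Tensor-anchored Weil transport in dimension 10** from the W-engine `hG` (every continuous section of
`FiberClass` of an embedded smooth projective family over a smooth quasi-projective irreducible base is the
global section of one class), Deligne's Weil family `hWF` and the transport step `hT` (a global class,
fibrewise rational `(5,5)`, algebraic at a tensor-isogenous fibre where it lies in the strong Weil plane, is
algebraic on every fibre) — the `(11,5)` instance of the sibling's landed
`TensorAnchor.weilEightfolds_of_engine_of_weilFamily_of_transport` (p108803), concluding THIS crux by name.
[cite: Deligne1982HodgeCycles, proof of Thm. 4.8 (pp. 47–52), Prop. 4.4, Lemma 4.5, Remark 4.10] -/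
theorem weilTenfolds_of_engine_of_weilFamily_of_transport
    (hG : ∀ ⦃𝒳 S : SchemeOver ℂ⦄ (f : 𝒳 ⟶ S) (n k : ℕ), IsSmoothProjectiveFamily f n →
      (∃ (N : ℕ) (ι : 𝒳 ⟶ projectiveSpace N ℂ ⊗ S),
          IsClosedImmersion ι.left ∧ ι ≫ snd (projectiveSpace N ℂ) S = f) →
      AlgebraicGeometry.Smooth S.hom → IsQuasiProjectiveOver S → IrreducibleSpace S.left →
      ∀ (σ : ComplexPoints S → FiberClass f k), Continuous σ → (∀ s, (σ s).pt = s) →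
        ∃ W : complexBetti 𝒳 k, ∀ s, σ s = globalSection f k W s)
    (hWF : deligne1982_weilFamily_hodgeWeilSection)
    (hT : ∀ ⦃𝒳 S : SchemeOver ℂ⦄ (f : 𝒳 ⟶ S), IsSmoothProjectiveFamily f 10 →
      (∃ (N : ℕ) (ι : 𝒳 ⟶ projectiveSpace N ℂ ⊗ S),
          IsClosedImmersion ι.left ∧ ι ≫ snd (projectiveSpace N ℂ) S = f) →
      IrreducibleSpace S.left → AlgebraicGeometry.Smooth S.hom → IsQuasiProjectiveOver S →
      ∀ (W : complexBetti 𝒳 10),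
        (∀ s : ComplexPoints S, IsRationalClass (complexBetti.map (fiberι f s) 10 W) ∧
          IsOfHodgeType 10 (fiberOver f s) 10 5 5 (complexBetti.map (fiberι f s) 10 W)) →
        (∀ s : ComplexPoints S, ∃ (A' : AbelianVariety ℂ) (φ' : A' ⟶ A'),
          A'.dim = 10 ∧ φ' ≫ φ' = -((11 : ℤ) • 𝟙 A') ∧ Nonempty (A'.X ≅ fiberOver f s)) →
        ∀ s₀ : ComplexPoints S,
          (∃ (Y : AbelianVariety ℂ) (Ψ : Y ⟶ Y) (e₀ : Y.X ≅ fiberOver f s₀) (A₁ : AbelianVariety ℂ)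
              (f₁ : Y ⟶ A₁.prod A₁) (g₁ : A₁.prod A₁ ⟶ Y) (m : ℕ),
            A₁.dim = 5 ∧ Y.dim = 10 ∧ Ψ ≫ Ψ = -((11 : ℤ) • 𝟙 Y) ∧ 0 < m ∧ f₁ ≫ g₁ = m • 𝟙 Y ∧
              Flat f₁.hom.hom.hom.left ∧
              g₁ ≫ Ψ = AbelianVariety.prodLift (AbelianVariety.snd A₁ A₁ ≫ (-((11 : ℤ) • 𝟙 A₁)))
                (AbelianVariety.fst A₁ A₁) ≫ g₁ ∧
              complexBetti.map e₀.hom 10 (complexBetti.map (fiberι f s₀) 10 W) ∈ weilClassesOf Y Ψ 5 11) →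
          complexBetti.map (fiberι f s₀) 10 W ∈ algebraicClasses (fiberOver f s₀) 5 →
          ∀ s : ComplexPoints S, complexBetti.map (fiberι f s) 10 W ∈ algebraicClasses (fiberOver f s) 5) :
    -- the crux UNFOLDED (only `WeilTenfoldsSqrtMinus11_of` concludes it by name in this workfile; the landed
    -- `Theorems/…OfWeilFamily` version concludes it by name)
    ∀ (A : AbelianVariety ℂ) (φ : A ⟶ A), A.dim = 10 → φ ≫ φ = -((11 : ℤ) • 𝟙 A) →
      ∀ c : complexBetti A.X 10, IsRationalClass c → IsOfHodgeType 10 A.X 10 5 5 c →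
        c ∈ Module.End.eigenspace (complexBetti.map (𝟙 A + φ).hom.hom.hom 10).hom
              ((1 + Complex.I * (Real.sqrt (11 : ℝ) : ℂ)) ^ 10) ⊔
            Module.End.eigenspace (complexBetti.map (𝟙 A + φ).hom.hom.hom 10).hom
              ((1 - Complex.I * (Real.sqrt (11 : ℝ) : ℂ)) ^ 10) →
        c ∈ algebraicClasses A.X 5 := by
  intro A φ hA hφ c hr hH hW
  by_cases hc : c = 0
  · rw [hc]
    exact Submodule.zero_mem _
  have hφ' : φ ≫ φ = -(((11 : ℕ) : ℤ) • 𝟙 A) := by exact_mod_cast hφ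
  have hA' : A.dim = 2 * 5 := hA
  have hcW : c ∈ weilClassesOf A φ 5 11 := by
    refine stub_upgrade 11 (by norm_num) (by norm_num) (by norm_num) 5 A φ hA' hφ' ?_
    exact_mod_cast hW
  obtain ⟨𝒳, S, f, s₁, s₀, e, σ, hfam, hι, hirr, hsm, hSqp, hfib, hσ, hpt, hHσ, hs₁, Y, Ψ, e₀, x,
    ⟨A₁, f₁, g₁, m, hA₁, hY, hΨ, hm, hfg, hf, hg⟩, hs₀, hx⟩ :=
    hWF 11 (by norm_num) (by norm_num) (by norm_num) 5 (by norm_num) A φ hA' hφ' c hcW hc hr hH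
  obtain ⟨W, hWσ⟩ := hG f (2 * 5) (2 * 5) hfam hι hsm hSqp hirr σ hσ hpt
  have hcls : ∀ (s : ComplexPoints S) (y : complexBetti (fiberOver f s) (2 * 5)),
      σ s = ⟨s, y⟩ → complexBetti.map (fiberι f s) (2 * 5) W = y := by
    intro s y hy
    have h := (hWσ s).symm.trans hy
    simp only [globalSection, FiberClass.mk.injEq, heq_eq_eq, true_and] at h
    exact h
  have hW₁ : complexBetti.map (fiberι f s₁) (2 * 5) W = complexBetti.map e.inv (2 * 5) c :=
    hcls s₁ _ hs₁
  have hW₀ : complexBetti.map (fiberι f s₀) (2 * 5) W = x := hcls s₀ x hs₀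
  have hrat₁ : IsRationalClass (σ s₁).cls := by
    rw [hs₁]; exact hr.map _
  have hratσ : ∀ s, IsRationalClass (σ s).cls :=
    stub_rationalAlongSection f (2 * 5) (2 * 5) hfam hsm hSqp hirr σ hσ hpt s₁ hrat₁
  have hfibre : ∀ s : ComplexPoints S,
      IsRationalClass (complexBetti.map (fiberι f s) (2 * 5) W) ∧
      IsOfHodgeType (2 * 5) (fiberOver f s) (2 * 5) 5 5 (complexBetti.map (fiberι f s) (2 * 5) W) := by
    intro s
    have h₁ := hratσ s
    have h₂ := hHσ s
    rw [hWσ s] at h₁ h₂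
    exact ⟨h₁, h₂⟩
  have hfib' : ∀ s : ComplexPoints S, ∃ (A' : AbelianVariety ℂ) (φ' : A' ⟶ A'),
      A'.dim = 10 ∧ φ' ≫ φ' = -((11 : ℤ) • 𝟙 A') ∧ Nonempty (A'.X ≅ fiberOver f s) := by
    intro s
    obtain ⟨A', φ', h1, h2, h3⟩ := hfib s
    exact ⟨A', φ', h1, by exact_mod_cast h2, h3⟩
  have h0 : complexBetti.map (fiberι f s₀) (2 * 5) W ∈ algebraicClasses (fiberOver f s₀) 5 := by
    rw [hW₀]
    exact owf_isoTransport _ Y e₀ 5 x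
      (owf_anchorAlgebraic (by norm_num) (by norm_num) (by norm_num) A₁ f₁ g₁ m hA₁ hY hΨ hm hfg hf hg hx)
  have hanchor : ∃ (Y : AbelianVariety ℂ) (Ψ : Y ⟶ Y) (e₀ : Y.X ≅ fiberOver f s₀)
      (A₁ : AbelianVariety ℂ) (f₁ : Y ⟶ A₁.prod A₁) (g₁ : A₁.prod A₁ ⟶ Y) (m : ℕ),
      A₁.dim = 5 ∧ Y.dim = 10 ∧ Ψ ≫ Ψ = -((11 : ℤ) • 𝟙 Y) ∧ 0 < m ∧ f₁ ≫ g₁ = m • 𝟙 Y ∧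
        Flat f₁.hom.hom.hom.left ∧
        g₁ ≫ Ψ = AbelianVariety.prodLift (AbelianVariety.snd A₁ A₁ ≫ (-((11 : ℤ) • 𝟙 A₁)))
          (AbelianVariety.fst A₁ A₁) ≫ g₁ ∧
        complexBetti.map e₀.hom 10 (complexBetti.map (fiberι f s₀) 10 W) ∈ weilClassesOf Y Ψ 5 11 := by
    refine ⟨Y, Ψ, e₀, A₁, f₁, g₁, m, hA₁, hY, by exact_mod_cast hΨ, hm, hfg, hf, by exact_mod_cast hg,
      ?_⟩
    have hx' : complexBetti.map e₀.hom (2 * 5) (complexBetti.map (fiberι f s₀) (2 * 5) W) ∈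
        weilClassesOf Y Ψ 5 11 := by
      rw [hW₀]; exact hx
    exact hx'
  have h1 : complexBetti.map (fiberι f s₁) (2 * 5) W ∈ algebraicClasses (fiberOver f s₁) 5 :=
    hT f hfam hι hirr hsm hSqp W hfibre hfib' s₀ hanchor h0 s₁
  have key := Theorems.isoInvariance_proof e 5 _ h1
  rw [hW₁, ← CategoryTheory.comp_apply, ← complexBetti.map_comp, Iso.hom_inv_id,
    complexBetti.map_id] at key
  exact key

/-- **Tensor-anchored Weil transport in dimension 10 is an instance of the route crux
`WeilVariationalHodge`** (stmt-HodgeConjecture-14497) at `(p, M) = (11, 5)`. -/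
theorem tensorTransport10_of_weilVariationalHodge
    (hV : Summit.HodgeConjecture.HodgeConjecture.Theses.HeckePrymWeil.WeilVariationalHodge) :
    ∀ ⦃𝒳 S : SchemeOver ℂ⦄ (f : 𝒳 ⟶ S), IsSmoothProjectiveFamily f 10 →
      (∃ (N : ℕ) (ι : 𝒳 ⟶ projectiveSpace N ℂ ⊗ S),
          IsClosedImmersion ι.left ∧ ι ≫ snd (projectiveSpace N ℂ) S = f) →
      IrreducibleSpace S.left → AlgebraicGeometry.Smooth S.hom → IsQuasiProjectiveOver S →
      ∀ (W : complexBetti 𝒳 10),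
        (∀ s : ComplexPoints S, IsRationalClass (complexBetti.map (fiberι f s) 10 W) ∧
          IsOfHodgeType 10 (fiberOver f s) 10 5 5 (complexBetti.map (fiberι f s) 10 W)) →
        (∀ s : ComplexPoints S, ∃ (A' : AbelianVariety ℂ) (φ' : A' ⟶ A'),
          A'.dim = 10 ∧ φ' ≫ φ' = -((11 : ℤ) • 𝟙 A') ∧ Nonempty (A'.X ≅ fiberOver f s)) →
        ∀ s₀ : ComplexPoints S,
          (∃ (Y : AbelianVariety ℂ) (Ψ : Y ⟶ Y) (e₀ : Y.X ≅ fiberOver f s₀) (A₁ : AbelianVariety ℂ)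
              (f₁ : Y ⟶ A₁.prod A₁) (g₁ : A₁.prod A₁ ⟶ Y) (m : ℕ),
            A₁.dim = 5 ∧ Y.dim = 10 ∧ Ψ ≫ Ψ = -((11 : ℤ) • 𝟙 Y) ∧ 0 < m ∧ f₁ ≫ g₁ = m • 𝟙 Y ∧
              Flat f₁.hom.hom.hom.left ∧
              g₁ ≫ Ψ = AbelianVariety.prodLift (AbelianVariety.snd A₁ A₁ ≫ (-((11 : ℤ) • 𝟙 A₁)))
                (AbelianVariety.fst A₁ A₁) ≫ g₁ ∧
              complexBetti.map e₀.hom 10 (complexBetti.map (fiberι f s₀) 10 W) ∈ weilClassesOf Y Ψ 5 11) →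
          complexBetti.map (fiberι f s₀) 10 W ∈ algebraicClasses (fiberOver f s₀) 5 →
          ∀ s : ComplexPoints S, complexBetti.map (fiberι f s) 10 W ∈ algebraicClasses (fiberOver f s) 5 := by
  intro 𝒳 S f hf _ hirr hsm _ W hall hfib s₀ _ h0 s
  exact hV 11 (by norm_num) (by norm_num) (by norm_num) 5 (by norm_num) f hf hirr hsm W hall
    (fun s' => by
      obtain ⟨A', φ', h1, h2, h3⟩ := hfib s'
      exact ⟨A', φ', h1, by exact_mod_cast h2, h3⟩)
    ⟨s₀, h0⟩ s

/-- **Sub-goal `stub_ofTwoFactsOfWeilVariationalHodge` (PROVED; registered by `stub-add` with the crux BY NAME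
as conclusion, landed as `Theorems/HeckePrymWeilWeilTenfoldsSqrtMinus11OfWeilFamily`): the crux from THREE
EXISTING declarations of the tree** — the accepted named facts `deligne1968_invariantClass_fromTotalSpace`
(Deligne 1968 / Voisin II Thm 4.18), `deligne1982_weilFamily_hodgeWeilSection` (Deligne LNM 900, proof of
Thm 4.8) and the route crux `WeilVariationalHodge` (stmt-HodgeConjecture-14497, OPEN) at `(11, 5)`. The
engine-agnostic residue of this crux: it is CLOSED MODULO these. (Unfolded conclusion here, so that the
skeleton audit sees exactly one theorem concluding the crux by name.) [cite: Deligne1968, Prop. (2.1) with (2.6.3)]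
[cite: VoisinHodgeII2003, Thm. 4.18] [cite: Deligne1982HodgeCycles, proof of Thm. 4.8 (pp. 47–52)] -/
theorem ofTwoFactsOfWeilVariationalHodge :
    deligne1968_invariantClass_fromTotalSpace → deligne1982_weilFamily_hodgeWeilSection →
      Summit.HodgeConjecture.HodgeConjecture.Theses.HeckePrymWeil.WeilVariationalHodge →
      ∀ (A : AbelianVariety ℂ) (φ : A ⟶ A), A.dim = 10 → φ ≫ φ = -((11 : ℤ) • 𝟙 A) →
        ∀ c : complexBetti A.X 10, IsRationalClass c → IsOfHodgeType 10 A.X 10 5 5 c →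
          c ∈ Module.End.eigenspace (complexBetti.map (𝟙 A + φ).hom.hom.hom 10).hom
                ((1 + Complex.I * (Real.sqrt (11 : ℝ) : ℂ)) ^ 10) ⊔
              Module.End.eigenspace (complexBetti.map (𝟙 A + φ).hom.hom.hom 10).hom
                ((1 - Complex.I * (Real.sqrt (11 : ℝ) : ℂ)) ^ 10) →
          c ∈ algebraicClasses A.X 5 :=
  fun hL hWF hV => weilTenfolds_of_engine_of_weilFamily_of_transport
    (stub_globalClassOfSection_of_leray hL) hWF (tensorTransport10_of_weilVariationalHodge hV)

/-- Read-back: the residue theorem IS the crux modulo the three declarations (definitional). -/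
example (hL : deligne1968_invariantClass_fromTotalSpace) (hWF : deligne1982_weilFamily_hodgeWeilSection)
    (hV : Summit.HodgeConjecture.HodgeConjecture.Theses.HeckePrymWeil.WeilVariationalHodge) :
    Summit.HodgeConjecture.HodgeConjecture.Theses.HeckePrymWeil.WeilTenfoldsSqrtMinus11 :=
  ofTwoFactsOfWeilVariationalHodge hL hWF hV

/-! ## §6 The v1 anchor stays algebraic (landed, lead c1): a second anchor for any future family fact -/

/-- **The crux holds on every NORM ANCHOR** (QM tenfold with `ψ¹¹ = 𝟙`, `Σψᵏ = 0`, `φ = g(ψ)`, divisorial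
`L`-signature `(1,1)⁵`) — verbatim the landed `…NormAnchorCrux` (p112065). Not consumed by v2's composition
(no family through norm anchors is typed in the tree); recorded as the line's second algebraic fibre. -/
theorem crux_on_normAnchors {A : AbelianVariety ℂ} {ψ φ : A ⟶ A}
    (hA : A.dim = 10) (h11 : (CategoryTheory.End.of ψ) ^ 11 = 1)
    (hnorm : (Finset.range 11).sum (fun k => (CategoryTheory.End.of ψ) ^ k) = 0)
    (hφ : (CategoryTheory.End.of φ) = (CategoryTheory.End.of ψ) + (CategoryTheory.End.of ψ) ^ 3 +
      (CategoryTheory.End.of ψ) ^ 4 + (CategoryTheory.End.of ψ) ^ 5 + (CategoryTheory.End.of ψ) ^ 9 -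
      (CategoryTheory.End.of ψ) ^ 2 - (CategoryTheory.End.of ψ) ^ 6 - (CategoryTheory.End.of ψ) ^ 7 -
      (CategoryTheory.End.of ψ) ^ 8 - (CategoryTheory.End.of ψ) ^ 10)
    (hsig : ∀ u : ℂ, u ^ 11 = 1 → u ≠ 1 →
      Module.End.eigenspace (complexBetti.map (𝟙 A + ψ).hom.hom.hom 2).hom ((1 + u) ^ 2) ≤
        algebraicClasses A.X 1) :
    ∀ c : complexBetti A.X 10,
      c ∈ Module.End.eigenspace (complexBetti.map (𝟙 A + φ).hom.hom.hom 10).hom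
            ((1 + Complex.I * (Real.sqrt (11 : ℝ) : ℂ)) ^ 10) ⊔
          Module.End.eigenspace (complexBetti.map (𝟙 A + φ).hom.hom.hom 10).hom
            ((1 - Complex.I * (Real.sqrt (11 : ℝ) : ℂ)) ^ 10) →
        c ∈ algebraicClasses A.X 5 :=
  Summit.HodgeConjecture.HodgeConjecture.Theorems.HeckePrymWeil.NormAnchor.weilTenfolds_conclusion_of_normAnchor_divisorial
    hA h11 hnorm hφ hsig

/-! ## §7 Sanity: no stub is a costume of the crux -/

/-- The crux, hypothesis by hypothesis (definitional read-back). -/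
example : Summit.HodgeConjecture.HodgeConjecture.Theses.HeckePrymWeil.WeilTenfoldsSqrtMinus11 ↔
    ∀ (A : AbelianVariety ℂ) (φ : A ⟶ A), A.dim = 10 → φ ≫ φ = -((11 : ℤ) • 𝟙 A) →
      ∀ c : complexBetti A.X (2 * 5), IsRationalClass c → IsOfHodgeType 10 A.X 10 5 5 c →
        c ∈ Module.End.eigenspace (complexBetti.map (𝟙 A + φ).hom.hom.hom (2 * 5)).hom
              ((1 + Complex.I * (Real.sqrt (11 : ℝ) : ℂ)) ^ 10) ⊔
            Module.End.eigenspace (complexBetti.map (𝟙 A + φ).hom.hom.hom (2 * 5)).hom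
              ((1 - Complex.I * (Real.sqrt (11 : ℝ) : ℂ)) ^ 10) →
        c ∈ algebraicClasses A.X 5 :=
  Iff.rfl

end Summit.HodgeConjecture.HodgeConjecture.Cruxes.WeilTenfoldsSqrtMinus11.QuaternionicNormAnchors

end
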